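import Literature.MathematicalPhysics.QuantumFieldTheory.Balaban1983to89.B8Thm2TorusKnitEstimatesOfMajorants
import Literature.MathematicalPhysics.QuantumFieldTheory.Balaban1983to89.B9B8KnitLetterCinvFromM56

/-!
# `Balaban1983to89.B8Thm2TorusKnitMajorantsOfSite` — M5.9 ASSEMBLY, FILE A7: the displayed majorant package `KnitMajorants` of file A4 with its (3.48) entry
# READ OFF M5.6's per-cube data at print's transporters (junction file 20 `B9B8KnitLetterCinvFromM56.hasMajorant_conj_XinvY_parKnitY_of_site`) — the package
# now names only [Balaban1985BackgroundPropagators] Thm 3.1-type SITE majorants of `η_S²G′`, `η_S⁻¹∇·η_S²G′` (M5.5's output shapes) and M5.6's per-cube inputs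

statement-level skeleton of published theorems with citation tags; proofs where landed; nothing here is a claim about the
Yang–Mills mass gap

T. Bałaban, *Propagators for lattice gauge theories in a background field*, Commun. Math. Phys. **99** (1985) 389–434 [`Balaban1985BackgroundPropagators`, "[4]"]:
Thm 3.1 (3.42) p. 397, Thm 3.2 (3.48) p. 398, Thm 3.9 p. 413, (3.95)–(3.96) p. 411, (3.87) p. 409, (3.19)–(3.25) pp. 393–395.  T. Bałaban, *Propagators and
renormalization transformations for lattice gauge theories. II*, Commun. Math. Phys. **96** (1984) 223–250 [`Balaban1984PropagatorsII`]: (2.52) p. 232, (2.54),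
(2.61)–(2.63) p. 234, (2.83) p. 237.  T. Bałaban, *Spaces of regular gauge field configurations on a lattice and gauge fixing conditions*, Commun. Math. Phys. **99**
(1985) 75–102 [`Balaban1985RegularSpaces`]: (1.91)–(1.98) pp. 91–92, (1.101) p. 93.  STATUS: published, refereed.

CITATION HEADER (lean-in-tree rule).  Cell `lit-balaban`, seat `lit-balaban-t2s-1` (gen 4), MODULE M5.9, file A7; sub-row G-B8-T2S (R3 `stmt-QuantumFields-19200`,
helper).  CONSUMED BY NAME: junction J-B file 20 (seat p33 gen 95) `hasMajorant_conj_XinvY_parKnitY_of_site` (= p21's M5.6 F6 `hasMajorant_conj_XinvY_final` at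
`parS := parKnitY`); `B6RandomWalk.hasMajorant_mono`; file A4's `KnitMajorants`.  p33's RECORD-JB-g95 names this an assembler one-liner («`_of_site` output → `hC`
after `hasMajorant_mono` rate-weakening exactly as in `knit_E15_constLev_of_site`»); here it is, packaged for file A4's binder.

WHAT THIS FILE PROVES (sorry-free; no definitions).
* ★★★ **`knitMajorants_of_site`** — at one member `i` and one background `U` (`G ≤ U(N)`, `G`-valued `U` with `G`-valued knit legs, `N ≥ 1`): file A4's
  `KnitMajorants i U b ιB Rr Hp d₁ ε₀ δ βₓ ρ_f A A₁ K c s` with `K := N·B₀·c₁(ρδ₀, α′)·(1 − (θ₁+θ₂+θ₃)c₁(ρδ₀, α′))⁻¹` FROM: the (3.42)₁-shape site majorant `hGm` of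
  `η_S²G′(U; parKnitY)` at rate `δ_G` (junction file 15's output shape), the (3.42)₂-shape site majorants `hDG μ` at rate `δ_D` (junction file 16's output shape),
  the site majorants `hGc` of the cube letters, M5.6's per-cube data VERBATIM (junction file 20's hypothesis list), the member's section `ιB`, scale `c_f = Lᵏ`, the
  final resummation data ((2.61) at `(ε₀, βₓ)`, row sum at `ρ_f`), and a common target rate `δ ≤ δ_G, δ_D, (1−α′)ρδ₀` (rate weakening `hasMajorant_mono`).

HONEST SCOPE.  Plumbing only; exactly M5.5's∕M5.6's scope at the knit letter: the site majorants (M5.5's cube data → junction files 9∕10∕15∕16), the per-cube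
`hC`∕`hloc` (M5.2-E), `hD` (GAP G-B9-05 — NOT derived in the tree), `hLip`, cover separation ∕ overlap, geometry and smallness are DISPLAYED hypotheses of the
printed shapes, inhabited by nothing here; count-neutral; N05 ∕ `stub_PV3A` NOT discharged; nothing continuum ∕ ℝ⁴ ∕ OS ∕ mass-gap ∕ Clay — the Yang–Mills mass gap
is NOT proved.  No `sorry`, no `axiom`, no `… : Prop` fact, no `instance`, no `notation`.  NEW file; nothing landed is modified.  Seat `lit-balaban-t2s-1` gen 4, 2026-08-28.
-/

noncomputable section

open scoped BigOperators

namespace Literature.MathematicalPhysics.QuantumFieldTheory.Balaban1983to89.B8Thm2TorusKnitMajorantsOfSite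

open Node00 B6KLevelCensusIndexV1 B6Geom246MultiLevelBox B9BackgroundsKLevelV1 B9Eq39Adjoint B9Thm311ReadingCoords B9Thm311DeltaPrimePos
open B6RandomWalk (HasMajorant Triangle254 Ineq261 Ineq263 hasMajorant_mono c1_nonneg)
open B9Thm34Ext (toB6)
open B9GeoNormsKLevelV1 (geo9K geo9K_len_kGeo)
open B9Eq352DivFormLetters (conj)
open B9Eq352GradLetters (diffLetter)
open B9Thm37CubeCoverCommutators (cutMulY)
open B9B8AveragingJunction (parKnitY)
open B9B8KnitLetterCinvFromM56 (hasMajorant_conj_XinvY_parKnitY_of_site)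
open B8Thm2TorusKnitEstimatesOfMajorants (KnitMajorants)
open scoped Matrix Matrix.Norms.L2Operator

variable {d ℓ : ℕ} {hd : 1 ≤ d + 1} {hL : Odd (ℓ + 1) ∧ 1 < ℓ + 1} {b₀ b₁ : ℝ}
variable (i : KIdx d ℓ hd hL b₀ b₁)
variable {N : ℕ} {G : Subgroup (Matrix (Fin N) (Fin N) ℂ)ˣ}
variable {ι : Type} [Fintype ι] [DecidableEq ι] (b : Module.Basis ι ℝ (Matrix (Fin N) (Fin N) ℂ))
variable [Fintype (geo9K i).Site] [DecidableEq (geo9K i).Site] {Rr : ℝ} {Hp : Prop} (ιB : BlkY i → IBondY i)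

/-- ★★★ **FILE A4's MAJORANT PACKAGE AT ONE MEMBER AND BACKGROUND, ITS (3.48) ENTRY READ OFF M5.6's PER-CUBE DATA AT PRINT's TRANSPORTERS** (junction file 20 +
rate weakening).  Inputs: `G ≤ U(N)` (`N ≥ 1`), `G`-valued `U` with `G`-valued knit legs; the section `ιB`, the scale `c_f = Lᵏ`; the (3.42)₁-shape site majorant of
`η_S²G′(U; parKnitY)` at rate `δ_G` and those of the cube letters `Oc`; the (3.42)₂-shape site majorants at rate `δ_D`; M5.6's per-cube data verbatim (junction file
20's list); the final resummation data (2.61) at `(ε₀, βₓ)` and the row sum at `ρ_f`; a common rate `δ` below `δ_G`, `δ_D`, `(1−α′)ρδ₀`.  Output: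
`KnitMajorants i U b ιB Rr Hp d₁ ε₀ δ βₓ ρ_f A A₁ (N·B₀·c₁(ρδ₀,α′)(1 − (θ₁+θ₂+θ₃)c₁(ρδ₀,α′))⁻¹) c s`.  No estimate proved; the Yang–Mills mass gap is NOT proved.
[cite: Balaban1985BackgroundPropagators, Thm 3.1 (3.42) p.397, Thm 3.2 (3.48) p.398, Thm 3.9 p.413, (3.95)–(3.96) p.411, (3.19) p.393; Balaban1984PropagatorsII, (2.52) p.232, (2.61)–(2.63) p.234, (2.83) p.237] -/
theorem knitMajorants_of_site [Nonempty (Fin N)] (hG : G ≤ B7Prop2Explicit.unitaryUnits (Matrix (Fin N) (Fin N) ℂ))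
    {U : CfgY (Matrix (Fin N) (Fin N) ℂ) i} (hU : ∀ μ x, U μ x ∈ G) (hpar : ∀ z w : SiteY i, parKnitY i U z w ∈ G)
    (hι : ∀ t, B6Ineq2142KLevelV1.β i.hN i.D i.hk (ιB t) = t) (hcf : i.cf = (((ℓ + 1 : ℕ) : ℝ)) ^ i.k)
    {κι : Type} [Fintype κι] (Oc : κι → SiteOpY (Matrix (Fin N) (Fin N) ℂ) i)
    {M₂ : ℝ} (hM₂ : 0 ≤ M₂) (hrepr : ∀ (v : Matrix (Fin N) (Fin N) ℂ) (j : ι), |b.repr v j| ≤ M₂ * ‖v‖) (d' d₂ : ℕ)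
    {A A₁ δG δD αG α₂ CG : ℝ} (hA : 0 ≤ A) (hA₁ : 0 ≤ A₁) (hCG : 0 ≤ CG) (hαGδ : 0 ≤ αG * δG) (hα₂0 : 0 ≤ α₂) (hα₂1 : α₂ ≤ 1)
    (hδG : 0 ≤ (1 - αG) * δG)
    (hSTG : B9Ineq347.ScaleTransfer (geo9K i) δG αG CG (fun a => (geo9K i).len a ^ 2))
    (h261G : Ineq261 d₂ (toB6 (geo9K i) Rr Hp) ((1 - αG) * δG) α₂)
    (hGm : HasMajorant (g := toB6 (geo9K i) Rr Hp) (fun p : SiteY i × ι => ιB (blkOf i.D.toDomains p.1))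
      (conj b ((etaS i ^ 2) • (GpY i (parKnitY i) U).restrictScalars ℝ)) (fun a a' => A * (geo9K i).len a ^ 2 * Real.exp (-(δG * (geo9K i).dist a a'))))
    (hDG : ∀ μ : Fin (d + 1), HasMajorant (g := toB6 (geo9K i) Rr Hp) (fun p : SiteY i × ι => ιB (blkOf i.D.toDomains p.1))
      (conj b (diffLetter (shiftY i) (UboxY i U) ((((etaS i : ℝ) : ℂ))⁻¹) (Sum.inl μ)) * conj b ((etaS i ^ 2) • (GpY i (parKnitY i) U).restrictScalars ℝ))
      (fun a a' => A₁ * (geo9K i).len a * Real.exp (-(δD * (geo9K i).dist a a'))))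
    (hGc : ∀ k, HasMajorant (g := toB6 (geo9K i) Rr Hp) (fun p : SiteY i × ι => ιB (blkOf i.D.toDomains p.1))
      (conj b ((etaS i ^ 2) • (Oc k U).restrictScalars ℝ)) (fun a a' => A * (geo9K i).len a ^ 2 * Real.exp (-(δG * (geo9K i).dist a a'))))
    {δ₀ aL aD αc αst asep ρ bb κG κD Dsep ℓ₀ ℓ₁ B₀ C Nn s α' θ₁ θ₂ θ₃ : ℝ} (hrate : aL * δ₀ ≤ (1 - α₂) * ((1 - αG) * δG))
    (Sχ S : κι → Finset (geo9K i).Site) (χ h : κι → BlkY i → ℝ) (Cl : κι → Module.End ℝ (BlkY i → Matrix (Fin N) (Fin N) ℂ))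
    (hs : (etaS i ^ 2 * etaS i ^ 2) * s = 1) (hκD : 0 ≤ κD) (hℓ₀ : 0 ≤ ℓ₀) (hℓ₁ : 0 ≤ ℓ₁) (hB₀ : 0 ≤ B₀) (hC0 : 0 ≤ C) (hN : 0 ≤ Nn)
    (hδ₀ : 0 ≤ δ₀) (hasep : 0 ≤ asep) (hρ : 0 ≤ ρ) (hρb : ρ ≤ bb) (hαc : 0 < αc * δ₀) (hα'1 : α' ≤ 1)
    (hsplit₁ : αst + asep + ρ ≤ aL) (hsplit₂ : αst + ρ ≤ aD) (hsplit₃ : αst + αc + ρ ≤ aL)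
    (hκG : κG = A ^ 2 * CG * B6.c1 d₂ ((1 - αG) * δG) α₂)
    (hθ₁ : θ₁ = Nn * (((M₂ * ∑ j, ‖b j‖) ^ 2 * κG) * B₀ * C * B6.c1 d' δ₀ (bb - ρ) * Real.exp (-(asep * δ₀ * Dsep))))
    (hθ₂ : θ₂ = Nn * (κD * Real.exp (-(2 * δ₀ * Dsep)) * B₀ * C * B6.c1 d' δ₀ (bb - ρ)))
    (hθ₃ : θ₃ = Nn * ((ℓ₀ + ℓ₁ * (αc * δ₀)⁻¹) * ((M₂ * ∑ j, ‖b j‖) ^ 2 * κG) * B₀ * C * B6.c1 d' δ₀ (bb - ρ)))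
    (htri : Triangle254 (toB6 (geo9K i) Rr Hp)) (hrefl : ∀ y : (geo9K i).Site, (geo9K i).dist y y = 0)
    (hsymm : ∀ a a' : (geo9K i).Site, (geo9K i).dist a a' = (geo9K i).dist a' a) (hdnn : ∀ a a' : (geo9K i).Site, 0 ≤ (geo9K i).dist a a')
    (hST : B9Ineq347.ScaleTransfer (geo9K i) δ₀ αst C (fun a => ((geo9K i).len a ^ 4)⁻¹)) (h261b : Ineq261 d' (toB6 (geo9K i) Rr Hp) δ₀ (bb - ρ))
    (h261 : Ineq261 d' (toB6 (geo9K i) Rr Hp) (ρ * δ₀) α') (h263 : Ineq263 d' (toB6 (geo9K i) Rr Hp) (ρ * δ₀) α')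
    (hsmall : (θ₁ + θ₂ + θ₃) * B6.c1 d' (ρ * δ₀) α' < 1)
    (hsq : ∀ t, ∑ k, h k t ^ 2 = 1) (hh : ∀ k t, |h k t| ≤ 1) (hS : ∀ k t, h k t ≠ 0 → ιB t ∈ S k)
    (hcnt : ∀ a : (geo9K i).Site, (∑ k, if a ∈ S k then (1 : ℝ) else 0) ≤ Nn)
    (hχ01 : ∀ k t, 0 ≤ χ k t ∧ χ k t ≤ 1) (hχS : ∀ k t, ιB t ∈ Sχ k → χ k t = 1)
    (hsep : ∀ k a, a ∉ Sχ k → ∀ a'' ∈ S k, Dsep ≤ (geo9K i).dist a a'')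
    (hLip : ∀ k (t t' : BlkY i), |h k t' - h k t| ≤ ℓ₀ + ℓ₁ * (geo9K i).dist (ιB t) (ιB t'))
    (hloc : ∀ k, (cutMulY (𝔸 := Matrix (Fin N) (Fin N) ℂ) (h k)).restrictScalars ℝ *
      ((cutMulY (𝔸 := Matrix (Fin N) (Fin N) ℂ) (χ k)).restrictScalars ℝ * (XY i (parKnitY i) (Oc k) U).restrictScalars ℝ) * Cl k *
        (cutMulY (𝔸 := Matrix (Fin N) (Fin N) ℂ) (h k)).restrictScalars ℝ =
      (cutMulY (𝔸 := Matrix (Fin N) (Fin N) ℂ) (h k)).restrictScalars ℝ * (cutMulY (𝔸 := Matrix (Fin N) (Fin N) ℂ) (h k)).restrictScalars ℝ)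
    (hC : ∀ k, HasMajorant (g := toB6 (geo9K i) Rr Hp) (fun p : BlkY i × ι => ιB p.1) (conj b (s • Cl k))
      (fun a a' => if a ∈ S k then B₀ * ((geo9K i).len a ^ 4)⁻¹ * Real.exp (-(bb * δ₀ * (geo9K i).dist a a')) else 0))
    (hD : ∀ k, HasMajorant (g := toB6 (geo9K i) Rr Hp) (fun p : BlkY i × ι => ιB p.1)
      (conj b ((etaS i ^ 2 * etaS i ^ 2) • ((XY i (parKnitY i) (GpY i (parKnitY i)) U).restrictScalars ℝ - (XY i (parKnitY i) (Oc k) U).restrictScalars ℝ)))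
      (fun a a'' => κD * Real.exp (-(2 * δ₀ * Dsep)) * (geo9K i).len a ^ 4 * Real.exp (-(aD * δ₀ * (geo9K i).dist a a''))))
    {d₁ : ℕ} {ε₀ βx ρf c δ : ℝ} (h261f : Ineq261 d₁ (toB6 (geo9K i) Rr Hp) ε₀ βx)
    (hrowf : ∀ a : (geo9K i).Site, ∑ a' : (geo9K i).Site, Real.exp (-(ρf * (geo9K i).dist a a')) ≤ c)
    (hle_G : δ ≤ δG) (hle_D : δ ≤ δD) (hle_C : δ ≤ (1 - α') * (ρ * δ₀)) :
    KnitMajorants i U b ιB Rr Hp d₁ ε₀ δ βx ρf A A₁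
      (Nn * B₀ * B6.c1 d' (ρ * δ₀) α' * (1 - (θ₁ + θ₂ + θ₃) * B6.c1 d' (ρ * δ₀) α')⁻¹) c s := by
  -- M5.6 FILE 6 at print's transporters (junction file 20)
  have hC' := hasMajorant_conj_XinvY_parKnitY_of_site i b ιB hG hU hpar Oc hM₂ hrepr d' d₂ hA hCG hαGδ hα₂0 hα₂1 hδG hSTG h261G hGm hGc hrate Sχ S χ h Cl
    hs hκD hℓ₀ hℓ₁ hB₀ hC0 hN hδ₀ hasep hρ hρb hαc hα'1 hsplit₁ hsplit₂ hsplit₃ hκG hθ₁ hθ₂ hθ₃ htri hrefl hsymm hdnn hST h261b h261 h263 hsmall hsq hh hS hcnt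
    hχ01 hχS hsep hLip hloc hC hD
  have hK : 0 ≤ Nn * B₀ * B6.c1 d' (ρ * δ₀) α' * (1 - (θ₁ + θ₂ + θ₃) * B6.c1 d' (ρ * δ₀) α')⁻¹ :=
    mul_nonneg (mul_nonneg (mul_nonneg hN hB₀) (c1_nonneg _ _ _)) (inv_nonneg.2 (by linarith))
  -- rate weakening to the common rate `δ`
  have hwk : ∀ {δ' : ℝ}, δ ≤ δ' → ∀ a a' : (geo9K i).Site,
      Real.exp (-(δ' * (geo9K i).dist a a')) ≤ Real.exp (-(δ * (geo9K i).dist a a')) := fun hδ a a' =>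
    Real.exp_le_exp.2 (neg_le_neg (mul_le_mul_of_nonneg_right hδ (hdnn a a')))
  exact
  { hι := hι
    hcf := hcf
    hs := hs
    hdnn := hdnn
    htri := htri
    h261 := h261f
    hrow := hrowf
    hGm := hasMajorant_mono (g := toB6 (geo9K i) Rr Hp) _ hGm fun a a' =>
      mul_le_mul_of_nonneg_left (hwk hle_G a a') (mul_nonneg hA (sq_nonneg _))
    hDG := fun μ => hasMajorant_mono (g := toB6 (geo9K i) Rr Hp) _ (hDG μ) fun a a' =>
      mul_le_mul_of_nonneg_left (hwk hle_D a a') (mul_nonneg hA₁ (by rw [geo9K_len_kGeo]; exact (len_pos i a).le))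
    hC := hasMajorant_mono (g := toB6 (geo9K i) Rr Hp) _ hC' fun a a' =>
      mul_le_mul_of_nonneg_left (hwk hle_C a a') (mul_nonneg hK (by positivity)) }

end Literature.MathematicalPhysics.QuantumFieldTheory.Balaban1983to89.B8Thm2TorusKnitMajorantsOfSite

end
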